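import Summits.NavierStokesRegularity.NavierStokesRegularity.Theorems.ScenarioCensusScrewBlowdownRecurrent
import HarnessLib

/-!
# LINE «screw-blowdown» port, part 5/13: v1.5 off-axis returns — `exists_offaxis_return`, `offaxis_zoom_symmetry`, `period_of_limit`

Re-homed for the scenario census (typer seat ns-census-typer-1 g7; lead g9 RULINGS [7] 20:33Z / [8] 21:03Z / [12](b) 21:58Z: «screw-blowdown v1.8 =
version of record; `Row_A13isqT` DECIDED IN KERNEL → CANDIDATE-DECIDED member under A13 (row already TREE); typer-1 slot 3 port of record =
`ScrewBlowdown_port_v1_8.lean` bb5f719a8be448dd (stub-free)»; lead g10 RULINGS [1](b) 22:36Z / [2] 22:42Z: «port v1.9 ffe1ad3d1d25e376 = port of record (idea-crit-3 DIFF-CHECK 22:40:40Z CONFORMS); slot 4 = its S3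
appendix ADMISSIBLE after slot 3»; ref PRE-CHECKs items 13 / 15 / 20 / 27): VERBATIM PORT of ns-idea-4 LINE g12-1 «screw-blowdown» PORT copy
`pub/ideators/ns-idea-4/lines/screw-blowdown/port/ScrewBlowdown_port_v1_9.lean` sha16 ffe1ad3d1d25e376 (2890 l.; lean check rc 0, 0 sorry; = the v1.8
port copy bb5f719a8be448dd as a literal prefix — itself the v1.7 copy 674e939b7b0b34e8 + the `LocalPersistence` attack appendix `…LP` + the consequences
`localPersistence_holds` / `farPastSpreading_holds` / `linearConeLiouville_holds` / `row_A13isqT_proved` — plus the v1.9 S3 block: `vanishingBlowdownLiouville_holds`,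
`row_ArecT_proved`; parts 1–3 landed while v1.8 was the copy of record, text identical),
split for the 400-line rule into `ScenarioCensusScrewBlowdown` (§1–§3: objects, the cell `Row_A13isqT`, obligation Props, S1 PROVED) →
`…Plumbing` (§4, S2 PROVED) → `…Bridges` (§5 + v1.3) → `…Recurrent` (v1.4, `Row_ArecT`) → `…OffAxis` (v1.5 a) → `…Cone` (v1.5 b:
`farPast_linearCone_smallness_of_screw`) → `…Residual` (v1.5 c + v1.6: `LinearConeLiouville`, DSS rungs) → `…Propagation` (v1.7: FS, LP,
reductions; the three class-general tools are NOT re-declared — taken BY NAME, general `E`, from `Theorems/TypeIAncientMildForwardUniqueness.lean`,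
ns-idea-4 extract a1b589f6dec7da83, p671177) → `…LPTools` / `…LPDuhamel` / `…LP` (the appendix: Gaussian locality, the three-term Oseen split,
time weights; `duhamel_bound`; the bootstrap `one_step` / `persist` / `localPersistence` + the consequences incl. `row_A13isqT_proved`) →
`…Vanishing` (v1.9: S3 proved, `row_ArecT_proved`) → `…Keys` (census keys `Row_A13isqT` / `Row_ArecT` + `_excluded`).  Lean text VERBATIM in namespaces `…Theorems.ScenarioCensus.ScrewBlowdown` / `…ScrewBlowdownLP` (the line's
`…Lines.ScrewBlowdownPort` / `…PortLP` re-homed; qualified references renamed accordingly); port edits: `local notation "E3"` → `abbrev E3` (the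
appendix `open`s it), `@[conjecture]` on `VanishingBlowdownLiouville` only (part 1 landed while S3 was open; an obligation node, now with the closed
witness `vanishingBlowdownLiouville_holds`), seven one-line docstrings added, `continuous_rotZ_angle'` not re-declared (it restates the tree's
`Literature.Analysis.FluidPDE.continuous_rotZ_angle`, gate lint `dedup.landed`; its uses renamed), the line's `set_option linter.unusedVariables false` dropped (five proof lambdas
bind the unused `θ₀ h` as `_ _`; the unused hypothesis binders of `hasVanishingBlowdown_of_axiallyRecurrent` / `pointwise_small_of_zoom_small` are spelled `_hu` / `_hΛ`,
statements otherwise identical); `set_option maxHeartbeats … in` of the appendix kept as in the line.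

No census VALUE is moved by this file (row A13 is TREE already; the lead books the member A13isq-T); NS regularity is NOT proved; (L′)
`SymmetryModuliCount.TypeIAncientLiouville` is untouched (hypothesis of bridges only); no summit statement is proved by this file.
-/

-- the summit and its single problem share the name `NavierStokesRegularity` (D-0017 nested layout)
set_option linter.dupNamespace false

namespace Summit.NavierStokesRegularity.NavierStokesRegularity.Theorems.ScenarioCensus.ScrewBlowdown

open Set Function Filter Topology
open Literature.Analysis Literature.Analysis.FluidPDE
open Summit.NavierStokesRegularity.NavierStokesRegularity.Theorems

/-! ### v1.5 — OFF-AXIS blow-downs: far from the axis a screw return linearises to a TRANSLATION (additive)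

Second geometric mechanism.  Zoom out by `μ_k = √(−t_k)` around centres `c_k` at horizontal distance `R_k` from the axis
with `R_k/μ_k → ∞` but `R_k ≤ K μ_k²` (a LINEAR cone `|x_h| ≤ K(−t)`).  By Dirichlet's pigeonhole there is a screw power
`g^N` with axial part `N h ≤ μ_k` whose rotation residue `φ` has `|φ| ≤ 2πh/μ_k`; after a further power normalising the
size, the symmetry `g^N` seen from `c_k` at scale `μ_k` is a rotation by `ψ_k → 0` composed with a translation `d_k`,
`1/2 ≤ ‖d_k‖ ≤ 2A₀`.  Hence every blow-down limit `W` along such centres is PERIODIC, `W(· + d₀) = W` with `d₀ ≠ 0`,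
and vanishes by the tree's periodic Liouville theorem `ScenarioCensus.PeriodicGauge.periodic_typeI_liouville_genuine`
(census A13, BY NAME, not restated).  With the on-axis mechanism (v1.2/1.3) this proves far-past smallness on every
LINEAR CONE about the axis (strictly larger than the parabolic cylinders of v1.3) and weakens the residual to
`LinearConeLiouville` (implied by S3, kernel-checked below).  Irrationality is used only on the axis; the off-axis step
holds for every turn.  Nothing of record is proved. -/

/-- Additivity of the rotation in the vector. -/
theorem rotZ_add_vec (θ : ℝ) (p q : E3) : rotZ θ (p + q) = rotZ θ p + rotZ θ q := by
  ext i; fin_cases i <;> simp [rotZ] <;> ring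

/-- Horizontal displacement of a rotation about the axis: `|R_ψ x − x|_h² = (2 − 2cos ψ)|x_h|²`. -/
theorem horiz_sq_rotZ_sub_self (ψ : ℝ) (x : E3) :
    (rotZ ψ x - x) 0 ^ 2 + (rotZ ψ x - x) 1 ^ 2 = (2 - 2 * Real.cos ψ) * (x 0 ^ 2 + x 1 ^ 2) := by
  have hsc := Real.sin_sq_add_cos_sq ψ
  simp [rotZ]
  linear_combination (x 0 ^ 2 + x 1 ^ 2) * hsc

/-- The rotation about the axis does not move the axial coordinate. -/
theorem rotZ_sub_self_apply_two (ψ : ℝ) (x : E3) : (rotZ ψ x - x) 2 = 0 := by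
  simp [rotZ]

/-- `‖R_ψ x − x‖ ≤ |ψ| |x_h|` (from `cos ψ ≥ 1 − ψ²/2`). -/
theorem norm_rotZ_sub_self_le (ψ : ℝ) (x : E3) :
    ‖rotZ ψ x - x‖ ≤ |ψ| * Real.sqrt (x 0 ^ 2 + x 1 ^ 2) := by
  have hr : 0 ≤ x 0 ^ 2 + x 1 ^ 2 := by positivity
  have hcos : 2 - 2 * Real.cos ψ ≤ ψ ^ 2 := by linarith [Real.one_sub_sq_div_two_le_cos (x := ψ)]
  have hsq : ‖rotZ ψ x - x‖ ^ 2 ≤ (|ψ| * Real.sqrt (x 0 ^ 2 + x 1 ^ 2)) ^ 2 := by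
    rw [EuclideanSpace.norm_eq, Real.sq_sqrt (Finset.sum_nonneg fun i _ => by positivity)]
    simp only [Fin.sum_univ_three, Real.norm_eq_abs, sq_abs]
    rw [rotZ_sub_self_apply_two, horiz_sq_rotZ_sub_self, mul_pow, sq_abs, Real.sq_sqrt hr]
    nlinarith
  exact (pow_le_pow_iff_left₀ (norm_nonneg _) (by positivity) two_ne_zero).1 hsq

/-- Jordan-type lower bound: for `|ψ| ≤ π`, `|R_ψ x − x|_h² ≥ (4/π²) ψ² |x_h|²`. -/
theorem horiz_sq_rotZ_sub_self_ge {ψ : ℝ} (hψ : |ψ| ≤ Real.pi) (x : E3) :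
    4 / Real.pi ^ 2 * ψ ^ 2 * (x 0 ^ 2 + x 1 ^ 2) ≤ (rotZ ψ x - x) 0 ^ 2 + (rotZ ψ x - x) 1 ^ 2 := by
  have hr : 0 ≤ x 0 ^ 2 + x 1 ^ 2 := by positivity
  have hcos : 4 / Real.pi ^ 2 * ψ ^ 2 ≤ 2 - 2 * Real.cos ψ := by
    have := Real.cos_le_one_sub_mul_cos_sq hψ
    have e : 4 / Real.pi ^ 2 * ψ ^ 2 = 2 * (2 / Real.pi ^ 2 * ψ ^ 2) := by ring
    rw [e]; linarith
  rw [horiz_sq_rotZ_sub_self]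
  exact mul_le_mul_of_nonneg_right hcos hr

/-- `‖e₃‖ = 1`. -/
theorem norm_eZ_eq_one : ‖(eZ : E3)‖ = 1 := by
  rw [EuclideanSpace.norm_eq]
  simp [eZ]

/-- **Dirichlet step.**  For drift `h > 0`, scale `μ ≥ h`, horizontal radius `0 < R ≤ K μ²`: there is a screw power
`N` and an integer `j` such that the residue `ψ = Nθ₀ − 2πj` and the axial part satisfy `|ψ| R/μ ≤ A₀`, `N h/μ ≤ A₀`
(`A₀ = 2πKh + 2`) and one of them is `≥ 1` (pigeonhole for `θ₀/2π` with denominators `≤ ⌊μ/h⌋`, then a power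
normalising `max(|φ| R/μ, k h/μ)` to `[1, A₀]`).  Holds for EVERY real `θ₀`. -/
theorem exists_offaxis_return (θ₀ : ℝ) {h μ R K : ℝ} (hh : 0 < h) (hμ : h ≤ μ) (hR : 0 < R) (hK : 0 < K)
    (hRK : R ≤ K * μ ^ 2) :
    ∃ N : ℕ, ∃ j : ℤ, |(N : ℝ) * θ₀ - (j : ℝ) * (2 * Real.pi)| * R / μ ≤ 2 * Real.pi * K * h + 2 ∧
      (N : ℝ) * h / μ ≤ 2 * Real.pi * K * h + 2 ∧
      (1 ≤ |(N : ℝ) * θ₀ - (j : ℝ) * (2 * Real.pi)| * R / μ ∨ 1 ≤ (N : ℝ) * h / μ) := by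
  have hμ0 : 0 < μ := hh.trans_le hμ
  have hπ := Real.pi_pos
  obtain ⟨n, hn⟩ : ∃ n : ℕ, n = ⌊μ / h⌋₊ := ⟨_, rfl⟩
  have hn1 : 0 < n := by
    rw [hn]
    exact Nat.floor_pos.2 (by rw [le_div_iff₀ hh, one_mul]; exact hμ)
  obtain ⟨k, hk0, hkn, hk⟩ := Real.exists_nat_abs_mul_sub_round_le (θ₀ / (2 * Real.pi)) hn1
  obtain ⟨j, hj⟩ : ∃ j : ℤ, j = round ((k : ℝ) * (θ₀ / (2 * Real.pi))) := ⟨_, rfl⟩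
  rw [← hj] at hk
  obtain ⟨φ, hφ⟩ : ∃ φ : ℝ, φ = (k : ℝ) * θ₀ - (j : ℝ) * (2 * Real.pi) := ⟨_, rfl⟩
  have hφ_eq : φ = (2 * Real.pi) * ((k : ℝ) * (θ₀ / (2 * Real.pi)) - (j : ℝ)) := by
    rw [hφ]; field_simp
  have hnμ : μ / h < (n : ℝ) + 1 := by rw [hn]; exact Nat.lt_floor_add_one _
  have hμn : μ < ((n : ℝ) + 1) * h := by rwa [div_lt_iff₀ hh] at hnμ
  have h1n : 1 / ((n : ℝ) + 1) ≤ h / μ := by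
    rw [div_le_div_iff₀ (by positivity) hμ0, one_mul]
    linarith
  have hφle : |φ| ≤ 2 * Real.pi * h / μ := by
    rw [hφ_eq, abs_mul, abs_of_pos (by positivity)]
    calc 2 * Real.pi * |(k : ℝ) * (θ₀ / (2 * Real.pi)) - (j : ℝ)| ≤ 2 * Real.pi * (1 / ((n : ℝ) + 1)) := by
          gcongr
      _ ≤ 2 * Real.pi * (h / μ) := by gcongr
      _ = 2 * Real.pi * h / μ := by ring
  -- the two sizes
  obtain ⟨a, ha⟩ : ∃ a : ℝ, a = |φ| * R / μ := ⟨_, rfl⟩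
  obtain ⟨ζ, hζ⟩ : ∃ ζ : ℝ, ζ = (k : ℝ) * h / μ := ⟨_, rfl⟩
  have ha0 : 0 ≤ a := by rw [ha]; positivity
  have haA : a ≤ 2 * Real.pi * K * h := by
    have hRμ : R / μ ^ 2 ≤ K := by rwa [div_le_iff₀ (by positivity)]
    calc a = |φ| * (R / μ) := by rw [ha]; ring
      _ ≤ (2 * Real.pi * h / μ) * (R / μ) := by gcongr
      _ = 2 * Real.pi * h * (R / μ ^ 2) := by field_simp
      _ ≤ 2 * Real.pi * h * K := by gcongr
      _ = 2 * Real.pi * K * h := by ring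
  have hk0' : (0 : ℝ) < k := Nat.cast_pos.2 hk0
  have hζ0 : 0 < ζ := by rw [hζ]; positivity
  have hζ1 : ζ ≤ 1 := by
    rw [hζ, div_le_one hμ0]
    have hnle : (n : ℝ) ≤ μ / h := by rw [hn]; exact Nat.floor_le (by positivity)
    have hnh : (n : ℝ) * h ≤ μ := by rwa [le_div_iff₀ hh] at hnle
    calc (k : ℝ) * h ≤ (n : ℝ) * h := by gcongr
      _ ≤ μ := hnh
  obtain ⟨M, hM⟩ : ∃ M : ℝ, M = max a ζ := ⟨_, rfl⟩
  have hM0 : 0 < M := by rw [hM]; exact lt_max_of_lt_right hζ0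
  have hKh : 0 ≤ 2 * Real.pi * K * h := by positivity
  have hMle : M ≤ 2 * Real.pi * K * h + 1 := by
    rw [hM]; exact max_le (by linarith) (by linarith)
  obtain ⟨m, hm⟩ : ∃ m : ℕ, m = ⌈1 / M⌉₊ := ⟨_, rfl⟩
  have hm1 : 1 ≤ (m : ℝ) * M := by
    have : 1 / M ≤ (m : ℝ) := by rw [hm]; exact Nat.le_ceil _
    rwa [div_le_iff₀ hM0] at this
  have hm2 : (m : ℝ) * M ≤ M + 1 := by
    have h1 : (m : ℝ) < 1 / M + 1 := by rw [hm]; exact Nat.ceil_lt_add_one (by positivity)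
    have h2 : (m : ℝ) * M ≤ (1 / M + 1) * M := mul_le_mul_of_nonneg_right h1.le hM0.le
    have h3 : (1 / M + 1) * M = 1 + M := by field_simp
    linarith
  have hψ : (((m * k : ℕ) : ℝ)) * θ₀ - (((m : ℤ) * j : ℤ) : ℝ) * (2 * Real.pi) = (m : ℝ) * φ := by
    push_cast; rw [hφ]; ring
  refine ⟨m * k, (m : ℤ) * j, ?_, ?_, ?_⟩
  · rw [hψ, abs_mul, Nat.abs_cast]
    calc (m : ℝ) * |φ| * R / μ = (m : ℝ) * a := by rw [ha]; ring
      _ ≤ (m : ℝ) * M := by gcongr; rw [hM]; exact le_max_left _ _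
      _ ≤ 2 * Real.pi * K * h + 2 := by linarith
  · calc (((m * k : ℕ) : ℝ)) * h / μ = (m : ℝ) * ζ := by push_cast; rw [hζ]; ring
      _ ≤ (m : ℝ) * M := by gcongr; rw [hM]; exact le_max_right _ _
      _ ≤ 2 * Real.pi * K * h + 2 := by linarith
  · rcases le_total ζ a with hza | haz
    · left
      rw [hψ, abs_mul, Nat.abs_cast]
      have hMa : M = a := by rw [hM]; exact max_eq_left hza
      calc (1 : ℝ) ≤ (m : ℝ) * M := hm1
        _ = (m : ℝ) * |φ| * R / μ := by rw [hMa, ha]; ring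
    · right
      have hMz : M = ζ := by rw [hM]; exact max_eq_right haz
      calc (1 : ℝ) ≤ (m : ℝ) * M := hm1
        _ = (((m * k : ℕ) : ℝ)) * h / μ := by rw [hMz, hζ]; push_cast; ring

/-- **The screw power seen from an off-axis centre at scale `μ`**: for the zoom `v(s,y) = μ u(μ² s, c + μ y)`
(`= nsRescale μ (u translated by c)`), the power `g^N` (rotation residue `ψ = Nθ₀ − 2πj`) acts as
`v(s, R_ψ y + d) = R_ψ v(s, y)` with `d = μ⁻¹(R_ψ c − c + N h e₃)`. -/
theorem offaxis_zoom_symmetry {θ₀ h : ℝ} {u : ℝ → E3 → E3} (hS : IsScrewEquivariant θ₀ h u) {μ : ℝ}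
    (hμ : 0 < μ) (c : E3) (N : ℕ) (j : ℤ) :
    ∀ s < (0 : ℝ), ∀ y : E3,
      nsRescale μ (fun t x => u t (c + x)) s
          (rotZ ((N : ℝ) * θ₀ - (j : ℝ) * (2 * Real.pi)) y +
            μ⁻¹ • (rotZ ((N : ℝ) * θ₀ - (j : ℝ) * (2 * Real.pi)) c - c + ((N : ℝ) * h) • eZ)) =
        rotZ ((N : ℝ) * θ₀ - (j : ℝ) * (2 * Real.pi)) (nsRescale μ (fun t x => u t (c + x)) s y) := by
  intro s hs y
  have hper : ∀ z : E3, rotZ ((N : ℝ) * θ₀ - (j : ℝ) * (2 * Real.pi)) z = rotZ ((N : ℝ) * θ₀) z := by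
    intro z
    have e := rotZ_add_int_mul_two_pi ((N : ℝ) * θ₀) (-j) z
    have e' : (N : ℝ) * θ₀ + ((-j : ℤ) : ℝ) * (2 * Real.pi) = (N : ℝ) * θ₀ - (j : ℝ) * (2 * Real.pi) := by
      push_cast; ring
    rw [e'] at e
    exact e
  have hSN : IsScrewEquivariant ((N : ℝ) * θ₀) ((N : ℝ) * h) u := by
    have := isScrewEquivariant_zmul hS (N : ℤ)
    simpa only [Int.cast_natCast] using this
  have hs' : μ ^ 2 * s < 0 := mul_neg_of_pos_of_neg (by positivity) hs
  simp only [nsRescale, hper]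
  have e1 : c + μ • (rotZ ((N : ℝ) * θ₀) y + μ⁻¹ • (rotZ ((N : ℝ) * θ₀) c - c + ((N : ℝ) * h) • eZ)) =
      rotZ ((N : ℝ) * θ₀) (c + μ • y) + ((N : ℝ) * h) • eZ := by
    rw [rotZ_add_vec, rotZ_smul, smul_add, smul_smul, mul_inv_cancel₀ hμ.ne', one_smul]
    abel
  rw [e1, hSN _ hs', rotZ_smul]

/-- **Limits inherit the linearised symmetry as a PERIOD**: if `F_i → f` locally uniformly, `f` is continuous,
`F_i(R_{ψ_i} y + d_i) = R_{ψ_i} F_i(y)` with `ψ_i → 0`, `d_i → d₀`, then `f(y + d₀) = f(y)`. -/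
theorem period_of_limit {F : ℕ → E3 → E3} {f : E3 → E3} (hF : TendstoLocallyUniformly F f atTop)
    (hf : Continuous f) {ψ : ℕ → ℝ} {d : ℕ → E3} {d₀ : E3} (hψ : Tendsto ψ atTop (𝓝 0))
    (hd : Tendsto d atTop (𝓝 d₀)) (hsym : ∀ i y, F i (rotZ (ψ i) y + d i) = rotZ (ψ i) (F i y)) (y : E3) :
    f (y + d₀) = f y := by
  have hpt : Tendsto (fun i => rotZ (ψ i) y + d i) atTop (𝓝 (y + d₀)) := by
    have h1 : Tendsto (fun i => rotZ (ψ i) y) atTop (𝓝 (rotZ 0 y)) :=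
      tendsto_rotZ_of_tendsto hψ tendsto_const_nhds
    rw [rotZ_zero] at h1
    exact h1.add hd
  have hL : Tendsto (fun i => F i (rotZ (ψ i) y + d i)) atTop (𝓝 (f (y + d₀))) :=
    hF.tendsto_comp hf.continuousAt hpt
  have hy : Tendsto (fun i => F i y) atTop (𝓝 (f y)) := hF.tendsto_comp hf.continuousAt tendsto_const_nhds
  have hR : Tendsto (fun i => rotZ (ψ i) (F i y)) atTop (𝓝 (rotZ 0 (f y))) := tendsto_rotZ_of_tendsto hψ hy
  rw [rotZ_zero] at hR
  exact tendsto_nhds_unique (hL.congr fun i => hsym i y) hR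

end Summit.NavierStokesRegularity.NavierStokesRegularity.Theorems.ScenarioCensus.ScrewBlowdown
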